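import Mathlib
import HarnessLib
import Summits.HubbardSuperconductivity.HubbardSuperconductivity.Theorems.KLProgrammeKLRegimeEngineTowerRemeasureSplit

/-!
# Route `KLProgramme` — crux K3 ENGINE (stmt-HubbardSuperconductivity-20437 `KLRegimeEngineV17F2`), stub (b) v2 / stub (C) (C2) located risk #17 «(C2)-MOMENTS»:
# THE WEIGHTED RE-MEASUREMENT JUMP FOR AN ARBITRARY TREE WEIGHT (split form, abstract constants) — the producer word of (R85a)(B) made checkable
# (plan g21 (R85a)(2) «k3c2-p3: GO NOW on the weight-generic re-issue of …RemeasureWt/…RemeasureSplit for any diamWeight»; seat hubbard-kl-k3c2-p3 g10)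

`…EngineTowerRemeasureWt/Split` (p589161/p589586) state the weighted jump in E1's carrier `klWtPinnedSumAt`, whose tree weight is the DEGREE-ONE
`klScaleWt L M β j = 1 + Λ_j·diam`.  The export twin of located risk #17 (order-≤ 5 two-leg moments at `Kₙ`, (R85a)(B)) runs the same machinery with the
degree-5 weight `w₅ = diamWeight (s ↦ (1 + Λₙ·s)⁵) (gridLabelDist …)`, an `IsTreeWeight` by `isTreeWeight_diamWeight`.  Nothing in the jump depends on the degree:
this file re-issues the split jump for an ARBITRARY tree weight `wt` on the lattice leg positions (`IsTreeWeight wt`, leg map `latticeLegPos (2·(2M))`), with the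
carrier written out (no new definition):
  `WPS(J, T, q, w) := ε^m · Σ_{X : X q = w} wt((univ.image X).image latticeLegPos) · ‖kernel (map (toLin' E(F_J)) T) (m+1) X‖`.

* `sum_pinned_treeWt_eq_sum_sector` — `WPS` as the label-then-position double sum `ε^m Σ_{σ: σ q = ℓ} Σ_{x: x q = y} wt(pos x)·‖W^{F_J}_σ(T)(x)‖`;
* **`treeWtPinnedSum_jump_le_split_of_consts (hwt : IsTreeWeight wt)`** — for `k + 1 ≤ J′`, momentum-conserving `T`, PAIR-WEIGHTED per-pair overlap sums
  `Σ ‖Θ(X″,X′)‖·wt{latticeLegPos X″, latticeLegPos X′} ≤ c₁ / c₁r` (p3's literal shape with `wt` for `klScaleWt … j`), a class `B` of coarse label tuples with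
  abstract counts `27·#{…} ≤ A₁` off `B` / `≤ A₂` on `B`, and bounds `N` (all coarse `WPS(k, T, q, ·)`) / `N_B` (on-class coarse sums):
  `WPS(J′, T, q, w) ≤ c₁^m·c₁r·ε^{m+1}·(A₁·N + A₂·N_B)`.
So the degree-5 (or Gevrey-weighted) re-measurement is in the tree the moment the degree-5 overlap constants are (p3's price word, (R85a)(3)); `B = ∅`, `N_B = 0`
recovers the un-split jump.  Everything is proved; no definitions; nothing about the model is asserted; nothing asserts superconductivity.
References: BGM 2006 §2.8 (2.82)–(2.84), (2.88)–(2.90), App. A3 Lemma A3.1 [cite: BenfattoGiulianiMastropietro2006].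
-/

noncomputable section

namespace Summit.HubbardSuperconductivity.HubbardSuperconductivity.Theorems.EngineV8

set_option linter.dupNamespace false -- summit = problem name (single-conjunct summit), D-0017

open Classical
open Real Finset Literature.MathematicalPhysics.QuantumLattice Literature.Probability.LatticeModels GrassmannAlgebra
open Literature.Probability.LatticeModels.BattleFederbush
open Literature.MathematicalPhysics.QuantumLattice.FermiRG
open Summit.HubbardSuperconductivity.HubbardSuperconductivity.Theorems.KLRegimeSplit
open Summit.HubbardSuperconductivity.HubbardSuperconductivity.Theorems.KLProgrammeLegKernels
open Summit.HubbardSuperconductivity.HubbardSuperconductivity.Theorems.DispersionFlow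
open Summit.HubbardSuperconductivity.HubbardSuperconductivity.Theorems.KLRegimeWick
open Summit.HubbardSuperconductivity.HubbardSuperconductivity.Theorems.TorusFourierL2

variable {L M : ℕ} [NeZero L] [NeZero M] {wt : Finset (ZMod (2 * (2 * M)) × TorusSite 2 L) → ℝ}

omit [NeZero M] in
/-- **The tree-weighted pinned sum as a label-then-position double sum** (any weight `wt` on lattice position sets): for `w = (y, ℓ)`,
`Σ_{X : X q = w} wt(latticeLegPos-image of X)·‖kernel (map E(F_J) T) (m+1) X‖ = Σ_{σ: σ q = ℓ} Σ_{x: x q = y} wt(pos x)·‖W^{F_J}_σ(T)(x)‖`. -/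
theorem sum_pinned_treeWt_eq_sum_sector (wt : Finset (ZMod (2 * (2 * M)) × TorusSite 2 L) → ℝ) (β μ : ℝ) (K : TrigPolyC4v) (J m : ℕ)
    (T : HubbardGrassmann L M) (q : Fin (m + 1)) (y : SpaceTimeIdx L M) (ℓ : SectorLeg (sectorCount J)) :
    ∑ X ∈ univ.filter (fun X : Fin (m + 1) → SpaceTimeIdx L M × SectorLeg (sectorCount J) => X q = (y, ℓ)),
        wt ((univ.image X).image (latticeLegPos (2 * (2 * M)))) *
          ‖kernel ℂ (ExteriorAlgebra.map (Matrix.toLin' (sectorAnalysisMatrix L M β (klAnisoFamily L M β μ K klE0 J))) T) (m + 1) X‖ =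
      ∑ σ ∈ univ.filter (fun σ : Fin (m + 1) → SectorLeg (sectorCount J) => σ q = ℓ),
        ∑ x ∈ univ.filter (fun x : Fin (m + 1) → SpaceTimeIdx L M => x q = y),
          wt ((univ.image x).image (fun x : SpaceTimeIdx L M => (((((2 * (x.1 : ℕ) : ℕ)) : ZMod (2 * (2 * M)))), x.2))) *
            ‖sectorisedKernel L M β (klAnisoFamily L M β μ K klE0 J) T (m + 1) σ x‖ := by
  rw [← sum_pinned_prod_eq (fun x σ =>
    wt ((univ.image x).image (fun x : SpaceTimeIdx L M => (((((2 * (x.1 : ℕ) : ℕ)) : ZMod (2 * (2 * M)))), x.2))) *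
      ‖sectorisedKernel L M β (klAnisoFamily L M β μ K klE0 J) T (m + 1) σ x‖) q y ℓ]
  refine sum_congr rfl fun Y _ => ?_
  rw [kernel_map_sectorAnalysis, image_latticeLegPos_eq_image_pos]

/-- **THE TREE-WEIGHTED JUMP, SPLIT FORM, at abstract constants, for ANY tree weight** (BGM 2006 (2.82)–(2.84), (2.88)–(2.90), Lemma A3.1; the producer word of
(R85a)(B)).  For `k + 1 ≤ J′`, `IsTreeWeight wt`, a momentum-conserving `T`, PAIR-WEIGHTED per-pair column / row sums of `‖E(klAnisoFamily J′)·S(F̃_k)‖` with the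
weight `wt{latticeLegPos X″, latticeLegPos X′}` (labels matched), a class `B` of coarse label tuples with counts `27·#{σ″ : σ″ q = ℓ″, σ″ refines σ′} ≤ A₁` off `B` /
`≤ A₂` on `B`, and bounds `N` on every coarse tree-weighted pinned sum at leg `q` / `N_B` on the on-class coarse sums: the fine tree-weighted pinned sum at
`(q, w)` is `≤ c₁^m·c₁r·ε^{m+1}·(A₁·N + A₂·N_B)`. [cite: BenfattoGiulianiMastropietro2006, §2.8 (2.82)-(2.84), (2.88)-(2.90), App. A3] -/
theorem treeWtPinnedSum_jump_le_split_of_consts (hwt : IsTreeWeight wt) {β : ℝ} (hβ : 0 < β) (μ : ℝ) (K : TrigPolyC4v) {k J' : ℕ}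
    (hJ : k + 1 ≤ J') (T : HubbardGrassmann L M)
    (hT : ∀ (m : ℕ) (X : Fin m → HubbardFieldIdx L M), ∑ i, signedMomentum L (X i).2 (X i).1.1.2 ≠ 0 → kernel ℂ T m X = 0)
    {c₁ c₁r : ℝ} (hc₁0 : 0 ≤ c₁) (hc₁r0 : 0 ≤ c₁r)
    (hcol₁ : ∀ (ω'' : Fin (sectorCount J')) (ω' : Fin (sectorCount k)) (σ c : Fin 2) (x' : SpaceTimeIdx L M),
      ∑ x'' : SpaceTimeIdx L M, ‖(sectorAnalysisMatrix L M β (klAnisoFamily L M β μ K klE0 J') *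
        sectorSubMatrix L M β (bgmFatMultiplier L M klE0 β (nambuXiCT L μ K) k)) (x'', ((ω'', σ), c)) (x', ((ω', σ), c))‖ *
          wt {latticeLegPos (2 * (2 * M)) ((x'', ((ω'', σ), c)) : SpaceTimeIdx L M × SectorLeg (sectorCount J')),
              latticeLegPos (2 * (2 * M)) ((x', ((ω', σ), c)) : SpaceTimeIdx L M × SectorLeg (sectorCount k))} ≤ c₁)
    (hrow₁ : ∀ (ω'' : Fin (sectorCount J')) (ω' : Fin (sectorCount k)) (σ c : Fin 2) (x'' : SpaceTimeIdx L M),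
      ∑ x' : SpaceTimeIdx L M, ‖(sectorAnalysisMatrix L M β (klAnisoFamily L M β μ K klE0 J') *
        sectorSubMatrix L M β (bgmFatMultiplier L M klE0 β (nambuXiCT L μ K) k)) (x'', ((ω'', σ), c)) (x', ((ω', σ), c))‖ *
          wt {latticeLegPos (2 * (2 * M)) ((x'', ((ω'', σ), c)) : SpaceTimeIdx L M × SectorLeg (sectorCount J')),
              latticeLegPos (2 * (2 * M)) ((x', ((ω', σ), c)) : SpaceTimeIdx L M × SectorLeg (sectorCount k))} ≤ c₁r)
    (m : ℕ) (B : Finset (Fin (m + 1) → SectorLeg (sectorCount k))) (q : Fin (m + 1)) (w : SpaceTimeIdx L M × SectorLeg (sectorCount J'))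
    {A₁ A₂ N NB : ℝ} (hA₁ : 0 ≤ A₁) (hA₂ : 0 ≤ A₂) (hN0 : 0 ≤ N) (hNB0 : 0 ≤ NB)
    (hRoff : ∀ (ℓ'' : SectorLeg (sectorCount J')) (σ' : Fin (m + 1) → SectorLeg (sectorCount k)), σ' ∉ B →
      (27 : ℝ) * ((((bgmSectorSet L M (klAnisoFamily L M β μ K klE0 J') (m + 1)).filter fun σ'' =>
        (∀ e ∈ ({q} : Finset (Fin (m + 1))), σ'' e = (fun _ : Fin (m + 1) => ℓ'') e) ∧ ∀ i,
        (∃ q' : FreqMomentum L M, klAnisoFamily L M β μ K klE0 J' (σ'' i).1.1 q' ≠ 0 ∧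
          bgmFatMultiplier L M klE0 β (nambuXiCT L μ K) k (σ' i).1.1 q' ≠ 0) ∧
        (σ' i).1.2 = (σ'' i).1.2 ∧ (σ' i).2 = (σ'' i).2).card : ℝ)) ≤ A₁)
    (hRon : ∀ (ℓ'' : SectorLeg (sectorCount J')) (σ' : Fin (m + 1) → SectorLeg (sectorCount k)), σ' ∈ B →
      (27 : ℝ) * ((((bgmSectorSet L M (klAnisoFamily L M β μ K klE0 J') (m + 1)).filter fun σ'' =>
        (∀ e ∈ ({q} : Finset (Fin (m + 1))), σ'' e = (fun _ : Fin (m + 1) => ℓ'') e) ∧ ∀ i,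
        (∃ q' : FreqMomentum L M, klAnisoFamily L M β μ K klE0 J' (σ'' i).1.1 q' ≠ 0 ∧
          bgmFatMultiplier L M klE0 β (nambuXiCT L μ K) k (σ' i).1.1 q' ≠ 0) ∧
        (σ' i).1.2 = (σ'' i).1.2 ∧ (σ' i).2 = (σ'' i).2).card : ℝ)) ≤ A₂)
    (hN : ∀ w' : SpaceTimeIdx L M × SectorLeg (sectorCount k),
      imagTimeWeight β M ^ m *
        ∑ X' ∈ univ.filter (fun X' : Fin (m + 1) → SpaceTimeIdx L M × SectorLeg (sectorCount k) => X' q = w'),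
          wt ((univ.image X').image (latticeLegPos (2 * (2 * M)))) *
            ‖kernel ℂ (ExteriorAlgebra.map (Matrix.toLin' (sectorAnalysisMatrix L M β (klAnisoFamily L M β μ K klE0 k))) T) (m + 1) X'‖ ≤ N)
    (hNB : ∀ (ℓ' : SectorLeg (sectorCount k)) (y' : SpaceTimeIdx L M),
      imagTimeWeight β M ^ m * ∑ σ' ∈ B.filter (fun σ' : Fin (m + 1) → SectorLeg (sectorCount k) => σ' q = ℓ'),
        ∑ x' ∈ univ.filter (fun x' : Fin (m + 1) → SpaceTimeIdx L M => x' q = y'),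
          wt ((univ.image x').image (fun x : SpaceTimeIdx L M => (((((2 * (x.1 : ℕ) : ℕ)) : ZMod (2 * (2 * M)))), x.2))) *
            ‖sectorisedKernel L M β (klAnisoFamily L M β μ K klE0 k) T (m + 1) σ' x'‖ ≤ NB) :
    imagTimeWeight β M ^ m *
        ∑ X ∈ univ.filter (fun X : Fin (m + 1) → SpaceTimeIdx L M × SectorLeg (sectorCount J') => X q = w),
          wt ((univ.image X).image (latticeLegPos (2 * (2 * M)))) *
            ‖kernel ℂ (ExteriorAlgebra.map (Matrix.toLin' (sectorAnalysisMatrix L M β (klAnisoFamily L M β μ K klE0 J'))) T) (m + 1) X‖ ≤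
      c₁ ^ m * c₁r * imagTimeWeight β M ^ (m + 1) * (A₁ * N + A₂ * NB) := by
  have hε0 : 0 ≤ imagTimeWeight β M := imagTimeWeight_nonneg hβ.le M
  set ε := imagTimeWeight β M with hεdef
  set F' := klAnisoFamily L M β μ K klE0 J' with hF'
  set Fk := klAnisoFamily L M β μ K klE0 k with hFk
  set gpos : SpaceTimeIdx L M → ZMod (2 * (2 * M)) × TorusSite 2 L :=
    fun x => (((((2 * (x.1 : ℕ) : ℕ)) : ZMod (2 * (2 * M)))), x.2) with hgpos
  obtain ⟨y, ℓ⟩ := w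
  set E : Finset (Fin (m + 1)) := {q} with hE
  set τ'' : Fin (m + 1) → SectorLeg (sectorCount J') := fun _ => ℓ with hτ''
  have hqE : q ∈ E := by simp [hE]
  have hfilt : ∀ {Ns : ℕ} (S : Finset (Fin (m + 1) → SectorLeg Ns)) (ℓ₀ : SectorLeg Ns),
      (S.filter fun σ : Fin (m + 1) → SectorLeg Ns => σ q = ℓ₀) = S.filter fun σ => ∀ e ∈ E, σ e = (fun _ : Fin (m + 1) => ℓ₀) e := by
    intro Ns S ℓ₀
    exact filter_congr fun σ _ => by simp [hE]
  -- (1) the fine tree-weighted pinned sum as the `E`-prescribed fine sum over `bgmSectorSet`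
  have h1 : ε ^ m * ∑ X ∈ univ.filter (fun X : Fin (m + 1) → SpaceTimeIdx L M × SectorLeg (sectorCount J') => X q = (y, ℓ)),
        wt ((univ.image X).image (latticeLegPos (2 * (2 * M)))) *
          ‖kernel ℂ (ExteriorAlgebra.map (Matrix.toLin' (sectorAnalysisMatrix L M β F')) T) (m + 1) X‖ =
      ε ^ m * ∑ σ'' ∈ (bgmSectorSet L M F' (m + 1)).filter (fun σ'' => ∀ e ∈ E, σ'' e = τ'' e),
        ∑ x'' ∈ univ.filter (fun x'' : Fin (m + 1) → SpaceTimeIdx L M => x'' q = y),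
          wt ((univ.image x'').image gpos) * ‖sectorisedKernel L M β F' T (m + 1) σ'' x''‖ := by
    rw [sum_pinned_treeWt_eq_sum_sector, hfilt univ ℓ]
    congr 1
    have hsub : (bgmSectorSet L M F' (m + 1)).filter (fun σ'' => ∀ e ∈ E, σ'' e = τ'' e) ⊆
        univ.filter (fun σ'' : Fin (m + 1) → SectorLeg (sectorCount J') => ∀ e ∈ E, σ'' e = τ'' e) :=
      filter_subset_filter _ (subset_univ _)
    refine (Finset.sum_subset hsub fun σ'' hσ''univ hσ''not => ?_).symm
    have hP := (mem_filter.1 hσ''univ).2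
    have hnot : σ'' ∉ bgmSectorSet L M F' (m + 1) := fun h => hσ''not (mem_filter.2 ⟨h, hP⟩)
    exact sum_eq_zero fun x'' _ => by rw [sectorisedKernel_eq_zero_of_not_mem_bgmSectorSet β F' T hT hnot x'', norm_zero, mul_zero]
  -- (2) coarse sums over all tuples = coarse tree-weighted pinned sums
  have hN₁ : ∀ (τ' : Fin (m + 1) → SectorLeg (sectorCount k)) (y' : SpaceTimeIdx L M),
      ε ^ m * ∑ σ' ∈ univ.filter (fun σ' : Fin (m + 1) → SectorLeg (sectorCount k) => ∀ e ∈ E, σ' e = τ' e),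
        ∑ x' ∈ univ.filter (fun x' : Fin (m + 1) → SpaceTimeIdx L M => x' q = y'),
          wt ((univ.image x').image gpos) * ‖sectorisedKernel L M β Fk T (m + 1) σ' x'‖ ≤ N := by
    intro τ' y'
    have hτ'E : (univ.filter fun σ' : Fin (m + 1) → SectorLeg (sectorCount k) => ∀ e ∈ E, σ' e = τ' e) =
        univ.filter fun σ' => ∀ e ∈ E, σ' e = (fun _ : Fin (m + 1) => τ' q) e :=
      filter_congr fun σ _ => by simp [hE]
    rw [hτ'E, ← hfilt univ (τ' q), ← sum_pinned_treeWt_eq_sum_sector]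
    exact hN (y', τ' q)
  -- (3) coarse sums over the class `B`
  have hN₂ : ∀ (τ' : Fin (m + 1) → SectorLeg (sectorCount k)) (y' : SpaceTimeIdx L M),
      ε ^ m * ∑ σ' ∈ B.filter (fun σ' : Fin (m + 1) → SectorLeg (sectorCount k) => ∀ e ∈ E, σ' e = τ' e),
        ∑ x' ∈ univ.filter (fun x' : Fin (m + 1) → SpaceTimeIdx L M => x' q = y'),
          wt ((univ.image x').image gpos) * ‖sectorisedKernel L M β Fk T (m + 1) σ' x'‖ ≤ NB := by
    intro τ' y'
    have hτ'E : (B.filter fun σ' : Fin (m + 1) → SectorLeg (sectorCount k) => ∀ e ∈ E, σ' e = τ' e) =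
        B.filter fun σ' => ∀ e ∈ E, σ' e = (fun _ : Fin (m + 1) => τ' q) e :=
      filter_congr fun σ _ => by simp [hE]
    rw [hτ'E, ← hfilt B (τ' q)]
    exact hNB (τ' q) y'
  -- (4) the tree-weighted re-sectorisation lemma with the class `B`
  have h27 : (0 : ℝ) < 27 := by norm_num
  have hR₁0 : 0 ≤ A₁ / 27 := div_nonneg hA₁ h27.le
  have hR₂0 : 0 ≤ A₂ / 27 := div_nonneg hA₂ h27.le
  have h2 := hubbardSectorPrescribedSumWt_klAniso_jump_le_split (L := L) (M := M) hwt gpos hβ μ K hJ T hc₁0 hc₁r0 hR₁0 hR₂0 hN0 hNB0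
    hcol₁ hrow₁ m (bgmSectorSet L M F' (m + 1)) B E τ'' q hqE
    (fun σ' hσ' => by rw [le_div_iff₀ h27, mul_comm]; exact hRoff ℓ σ' hσ')
    (fun σ' hσ' => by rw [le_div_iff₀ h27, mul_comm]; exact hRon ℓ σ' hσ') hN₁ hN₂ y
  -- (5) assemble
  rw [h1]
  refine h2.trans (le_of_eq ?_)
  have hcard : E.card = 1 := by simp [hE]
  rw [hcard]
  field_simp
  ring

/-- **The degree-`d` diameter weight is a tree weight** (the carrier weight of (R85a)(B): `d = 5`; `d = 1` is `klScaleWt`):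
`diamWeight (s ↦ (1 + Λ·s)^d) (gridLabelDist L (2·(2M)) β)` for `0 ≤ Λ`, `0 ≤ β`. -/
theorem isTreeWeight_diamWeight_pow {β Λ : ℝ} (hβ : 0 ≤ β) (hΛ : 0 ≤ Λ) (d : ℕ) :
    IsTreeWeight (diamWeight (fun s => (1 + Λ * s) ^ d) (gridLabelDist L (2 * (2 * M)) β)) := by
  haveI : NeZero (2 * (2 * M)) := ⟨by have := NeZero.ne M; omega⟩
  refine isTreeWeight_diamWeight (isLabelDist_gridLabelDist L (2 * (2 * M)) hβ) (fun s hs => ?_) (fun s t hs hst => ?_)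
    (fun s t hs ht => ?_)
  · exact one_le_pow₀ (by nlinarith)
  · exact pow_le_pow_left₀ (by nlinarith) (by nlinarith) d
  · rw [← mul_pow]
    exact pow_le_pow_left₀ (by nlinarith) (by nlinarith [mul_nonneg (mul_nonneg hΛ hs) (mul_nonneg hΛ ht)]) d

end Summit.HubbardSuperconductivity.HubbardSuperconductivity.Theorems.EngineV8

end
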